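import Mathlib.GroupTheory.FreeGroup.NielsenSchreier
import HarnessLib

/-!
# The spanning-tree (Schreier) basis of a vertex group of a free groupoid

Topic `Literature/GroupTheory/CombinatorialGroupTheory`.  Mathlib's Nielsen–Schreier file
(`Mathlib/GroupTheory/FreeGroup/NielsenSchreier.lean`, D. Wärn) proves, for a free groupoid `Y` with an
arborescence (rooted spanning tree) `T` of its generating quiver, that the vertex group `End r` at the root
is a free GROUP (`IsFreeGroupoid.SpanningTree.endIsFree`) — but only as the `Prop`-valued class
`IsFreeGroup`, so the classical description of the BASIS — the loops `treeHom a ≫ e ≫ (treeHom b)⁻¹`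
through the generating arrows `e : a ⟶ b` NOT in the tree; in Schreier's transversal language the elements
`γ(tx) = tx·(t̄x̄)⁻¹ ≠ 1` of Lyndon–Schupp, *Combinatorial Group Theory*, Ch. I Prop. 3.7 (2) — is not
available by name, and Mathlib's auxiliary definitions are stated at a private copy of the root.  This file
re-develops that section with a public root `rootObj T` (definitions and proofs follow Mathlib's, due to
D. Wärn, essentially verbatim) and records the basis as data, plus the bookkeeping used by the free-factor
form of M. Hall's theorem (`FreeFactorFiniteIndex.lean`):

* `homOfPath`, `treeHom`, `loopOfHom`, `loopOfHom_eq_id`, `functorOfMonoidHom` — as in Mathlib;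
* `treeBasis T : FreeGroupBasis (LoopIndex T) (End (rootObj T))`, indexed by the generating arrows outside
  the tree, with `treeBasis_apply : treeBasis T e = loopOfHom T (of e)` (universal property = Mathlib's
  proof of `endIsFree`);
* `homOfSymmPath T p : rootObj T ⟶ a`, the morphism spelled by a path `p` from the root in the SYMMETRISED
  generating quiver (a forward arrow `e` contributes `of e`, a backward one `inv (of e)`);
* `homOfSymmPath_comp_inv_treeHom_mem` (telescoping): `homOfSymmPath T p ≫ inv (treeHom T a)` lies in the
  subgroup of `End (rootObj T)` generated by the loops of the arrows occurring in `p`; so a closed path at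
  the root spells an element of the subgroup generated by the loops of its own arrows
  (`homOfSymmPath_mem_loopSubgroup`).

References: R. C. Lyndon, P. E. Schupp, *Combinatorial Group Theory*, Springer Classics (2001), Ch. I
Prop. 3.7 (Schreier 1927 / M. Hall 1949 / Burns 1969; read in the cell's galaxy copy, chunk 26);
J.-P. Serre, *Trees* (1980), I.3.  No new mathematics.  The `backward.*` options below are the ones
Mathlib itself uses on the corresponding declarations (type synonyms `Generators Y` / `T` for `Y`).
-/

namespace Literature.GroupTheory.CombinatorialGroupTheory

namespace FreeGroupoidTree

open CategoryTheory CategoryTheory.SingleObj Quiver IsFreeGroupoid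

universe u

noncomputable section

variable {Y : Type u} [Groupoid.{u} Y] [IsFreeGroupoid Y]
  (T : WideSubquiver (Symmetrify (Generators Y))) [Arborescence T]

/-! ## The spanning-tree section of Mathlib's Nielsen–Schreier file, with a public root -/

/-- The root of the arborescence `T`, as an object of the groupoid `Y`.
[cite: LyndonSchupp2001, Ch. I Prop. 3.7] -/
abbrev rootObj : Y :=
  Quiver.root T

/-- The root of the arborescence `T`, as a vertex of the symmetrised generating quiver.
[cite: LyndonSchupp2001, Ch. I Prop. 3.7] -/
abbrev rootVtx : Symmetrify (Generators Y) :=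
  Quiver.root T

/-- A path in the tree from the root gives a morphism of `Y`, by composition (forward generating arrows
`e ↦ of e`, backward ones `e ↦ inv (of e)`). [cite: LyndonSchupp2001, Ch. I Prop. 3.7] -/
def homOfPath : ∀ {a : Y}, Path (root T) a → (rootObj T ⟶ a)
  | _, Path.nil => 𝟙 _
  | _, Path.cons p f => homOfPath p ≫ Sum.recOn f.val (fun e => of e) fun e => inv (of e)

/-- For every object `a` there is a canonical morphism from the root, along the unique tree path (the
Schreier representative `t̄`). [cite: LyndonSchupp2001, Ch. I Prop. 3.7] -/
def treeHom (a : Y) : rootObj T ⟶ a :=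
  homOfPath T default

/-- Any tree path to `a` gives `treeHom T a`, since paths in the tree are unique.
[cite: LyndonSchupp2001, Ch. I Prop. 3.7] -/
theorem treeHom_eq {a : Y} (p : Path (root T) a) : treeHom T a = homOfPath T p := by
  rw [treeHom, Unique.default_eq]

/-- `treeHom` of the root is the identity. [cite: LyndonSchupp2001, Ch. I Prop. 3.7] -/
@[simp]
theorem treeHom_root : treeHom T (rootObj T) = 𝟙 _ :=
  _root_.trans (treeHom_eq T Path.nil) rfl

/-- Any morphism of `Y` becomes a loop at the root after conjugating with `treeHom`s (Schreier's
`γ(w) = w · w̄⁻¹`). [cite: LyndonSchupp2001, Ch. I Prop. 3.7] -/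
def loopOfHom {a b : Y} (p : a ⟶ b) : End (rootObj T) :=
  treeHom T a ≫ p ≫ inv (treeHom T b)

set_option backward.isDefEq.respectTransparency false in
/-- Turning a tree arrow into a loop gives the identity loop.
[cite: LyndonSchupp2001, Ch. I Prop. 3.7] -/
theorem loopOfHom_eq_id {a b : Generators Y} (e) (H : e ∈ wideSubquiverSymmetrify T a b) :
    loopOfHom T (of e) = 𝟙 (rootObj T) := by
  rw [loopOfHom, ← Category.assoc, IsIso.comp_inv_eq, Category.id_comp]
  rcases H with H | H
  · rw [treeHom_eq T (Path.cons default ⟨Sum.inl e, H⟩), homOfPath]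
    rfl
  · rw [treeHom_eq T (Path.cons default ⟨Sum.inr e, H⟩), homOfPath]
    simp only [IsIso.inv_hom_id, Category.comp_id, Category.assoc, treeHom]

/-- Since every morphism gives a loop, a homomorphism out of the root vertex group extends to a functor on
the whole groupoid. [cite: LyndonSchupp2001, Ch. I Prop. 3.7] -/
@[simps]
def functorOfMonoidHom {X} [Monoid X] (f : End (rootObj T) →* X) : Y ⥤ CategoryTheory.SingleObj X where
  obj _ := ()
  map p := f (loopOfHom T p)
  map_id := by
    intro a
    dsimp only [loopOfHom]
    rw [Category.id_comp, IsIso.hom_inv_id, ← End.one_def, f.map_one, id_as_one]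
  map_comp := by
    intros
    rw [comp_as_mul, ← f.map_mul]
    simp only [IsIso.inv_hom_id_assoc, loopOfHom, End.mul_def, Category.assoc]

/-- The arrows of the spanning tree, as a set of "total" arrows of the generating quiver (an arrow is in
the tree when it or its reversal is an arrow of `T`). [cite: LyndonSchupp2001, Ch. I Prop. 3.7] -/
def treeArrows : Set (Total (Generators Y)) :=
  wideSubquiverEquivSetTotal (wideSubquiverSymmetrify T)

omit [Arborescence T] in
/-- Membership in `treeArrows`. [cite: LyndonSchupp2001, Ch. I Prop. 3.7] -/
theorem mem_treeArrows_iff (e : Total (Generators Y)) :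
    e ∈ treeArrows T ↔ e.hom ∈ wideSubquiverSymmetrify T e.left e.right :=
  Iff.rfl

/-- The index type of the spanning-tree basis: the generating arrows NOT in the tree (Lyndon–Schupp's
`γ(tx) ≠ 1`). [cite: LyndonSchupp2001, Ch. I Prop. 3.7] -/
abbrev LoopIndex : Type u :=
  ↥(treeArrows T)ᶜ

set_option backward.isDefEq.respectTransparency false in
/-- **The spanning-tree (Schreier) basis** of the vertex group at the root of a free groupoid:
`End (rootObj T)` is freely generated by the loops `treeHom a ≫ of e ≫ inv (treeHom b)` of the generating
arrows `e : a ⟶ b` outside the tree `T` — Lyndon–Schupp Ch. I Prop. 3.7 (2) ("the set `Y` of all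
`γ(tx) ≠ 1` … is a basis for a free group") in the groupoid rendering of Mathlib's Nielsen–Schreier file.
The universal property is Mathlib's `IsFreeGroupoid.SpanningTree.endIsFree` (D. Wärn), whose proof is
reproduced here because Mathlib states the result as the `Prop` `IsFreeGroup` and the basis is needed as
data. [cite: LyndonSchupp2001, Ch. I Prop. 3.7] -/
def treeBasis : FreeGroupBasis (LoopIndex T) (End (rootObj T)) :=
  FreeGroupBasis.ofUniqueLift (LoopIndex T) (fun e => loopOfHom T (of e.val.hom))
    (by
      classical
      intro X _ f
      let f' : Labelling (Generators Y) X := fun a b e =>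
        if h : (⟨a, b, e⟩ : Total (Generators Y)) ∈ treeArrows T then 1 else f ⟨⟨a, b, e⟩, h⟩
      rcases unique_lift f' with ⟨F', hF', uF'⟩
      refine ⟨F'.mapEnd _, ?_, ?_⟩
      · suffices ∀ {x y} (q : x ⟶ y), F'.map (loopOfHom T q) = (F'.map q : X) by
          rintro ⟨⟨a, b, e⟩, h⟩
          simp only [Functor.mapEnd, DFunLike.coe, this, hF']
          exact dif_neg h
        intro x y q
        suffices ∀ {a} (p : Path (root T) a), F'.map (homOfPath T p) = 1 by
          simp only [this, treeHom, comp_as_mul, inv_as_inv, loopOfHom, inv_one, mul_one,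
            one_mul, Functor.map_inv, Functor.map_comp]
        intro a p
        induction p with
        | nil => rw [homOfPath, F'.map_id, id_as_one]
        | cons p e ih =>
          rw [homOfPath, F'.map_comp, comp_as_mul, ih, mul_one]
          rcases e with ⟨e | e, eT⟩
          · rw [hF']
            exact dif_pos (Or.inl eT)
          · rw [F'.map_inv, inv_as_inv, inv_eq_one, hF']
            exact dif_pos (Or.inr eT)
      · intro E hE
        ext x
        suffices (functorOfMonoidHom T E).map x = F'.map x by
          simpa only [loopOfHom, functorOfMonoidHom, IsIso.inv_id, treeHom_root,
            Category.id_comp, Category.comp_id] using! this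
        congr
        apply uF'
        intro a b e
        change E (loopOfHom T _) = dite _ _ _
        split_ifs with h
        · rw [loopOfHom_eq_id T e h, ← End.one_def, E.map_one]
        · exact hE ⟨⟨a, b, e⟩, h⟩)

/-- The basis vector at a non-tree arrow `e : a ⟶ b` is the loop `treeHom a ≫ of e ≫ inv (treeHom b)`
(`γ(tx) = tx (t̄x̄)⁻¹`). [cite: LyndonSchupp2001, Ch. I Prop. 3.7] -/
theorem treeBasis_apply (e : LoopIndex T) : treeBasis T e = loopOfHom T (of e.val.hom) := by
  change FreeGroup.lift (fun e : LoopIndex T => loopOfHom T (of e.val.hom)) (FreeGroup.of e) = _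
  rw [FreeGroup.lift_apply_of]

/-- A loop through a tree arrow is trivial, as an equation in the group `End (rootObj T)`.
[cite: LyndonSchupp2001, Ch. I Prop. 3.7] -/
theorem loopOfHom_eq_one {a b : Generators Y} (e : a ⟶ b)
    (h : (⟨a, b, e⟩ : Total (Generators Y)) ∈ treeArrows T) :
    loopOfHom T (of e) = (1 : End (rootObj T)) := by
  rw [End.one_def]
  exact loopOfHom_eq_id T e h

/-! ## Paths in the symmetrised generating quiver -/

/-- A vertex of the (symmetrised) generating quiver, as an object of `Y` (the identity map).
[cite: LyndonSchupp2001, Ch. I Prop. 3.7] -/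
abbrev obj (a : Symmetrify (Generators Y)) : Y := a

omit [Arborescence T] in
/-- The morphism of `Y` named by an arrow of the symmetrised generating quiver: a forward generating
arrow `e` gives `of e`, a backward one `inv (of e)`. [cite: LyndonSchupp2001, Ch. I Prop. 3.7] -/
def homOfSymmArrow {b c : Symmetrify (Generators Y)} (f : b ⟶ c) : (obj b ⟶ obj c) :=
  match f with
  | Sum.inl e => of e
  | Sum.inr e => inv (of e)

/-- The morphism `rootObj T ⟶ a` spelled by a path from the root in the symmetrised generating quiver.
[cite: LyndonSchupp2001, Ch. I Prop. 3.7] -/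
def homOfSymmPath : ∀ {a : Symmetrify (Generators Y)}, Path (rootVtx T) a →
    (rootObj T ⟶ obj a)
  | _, Path.nil => 𝟙 _
  | _, Path.cons p f => homOfSymmPath p ≫ homOfSymmArrow f

/-- `homOfSymmPath` of the empty path. [cite: LyndonSchupp2001, Ch. I Prop. 3.7] -/
theorem homOfSymmPath_nil :
    homOfSymmPath T (Path.nil : Path (rootVtx T) (rootVtx T)) = 𝟙 _ := rfl

/-- `homOfSymmPath` of an extended path. [cite: LyndonSchupp2001, Ch. I Prop. 3.7] -/
theorem homOfSymmPath_cons {a b : Symmetrify (Generators Y)}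
    (p : Path (rootVtx T) a) (f : a ⟶ b) :
    homOfSymmPath T (p.cons f) = homOfSymmPath T p ≫ homOfSymmArrow f := rfl

omit [Arborescence T] in
/-- The predicate `P` on generating arrows, evaluated on the generating arrow underlying an arrow of the
symmetrised quiver. [cite: LyndonSchupp2001, Ch. I Prop. 3.7] -/
def SymmArrowSat (P : ∀ ⦃a b : Generators Y⦄, (a ⟶ b) → Prop) {b c : Symmetrify (Generators Y)}
    (f : b ⟶ c) : Prop :=
  match f with
  | Sum.inl e => P e
  | Sum.inr e => P e

/-- "Every arrow occurring in the path `p` satisfies `P`". [cite: LyndonSchupp2001, Ch. I Prop. 3.7] -/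
def PathForall (P : ∀ ⦃a b : Generators Y⦄, (a ⟶ b) → Prop) :
    ∀ {a : Symmetrify (Generators Y)}, Path (rootVtx T) a → Prop
  | _, Path.nil => True
  | _, Path.cons p f => PathForall P p ∧ SymmArrowSat P f

/-- `PathForall` of the empty path. [cite: LyndonSchupp2001, Ch. I Prop. 3.7] -/
theorem pathForall_nil (P : ∀ ⦃a b : Generators Y⦄, (a ⟶ b) → Prop) :
    PathForall T P (Path.nil : Path (rootVtx T) (rootVtx T)) := trivial

/-- `PathForall` of an extended path. [cite: LyndonSchupp2001, Ch. I Prop. 3.7] -/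
theorem pathForall_cons {P : ∀ ⦃a b : Generators Y⦄, (a ⟶ b) → Prop} {a b : Symmetrify (Generators Y)}
    (p : Path (rootVtx T) a) (f : a ⟶ b) :
    PathForall T P (p.cons f) ↔ PathForall T P p ∧ SymmArrowSat P f := Iff.rfl

/-- The subgroup of the root vertex group generated by the loops of the generating arrows satisfying `P`.
[cite: LyndonSchupp2001, Ch. I Prop. 3.7] -/
def loopSubgroup (P : ∀ ⦃a b : Generators Y⦄, (a ⟶ b) → Prop) : Subgroup (End (rootObj T)) :=
  Subgroup.closure {x | ∃ (a b : Generators Y) (e : a ⟶ b), P e ∧ x = loopOfHom T (of e)}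

/-- Loops of `P`-arrows lie in `loopSubgroup T P`. [cite: LyndonSchupp2001, Ch. I Prop. 3.7] -/
theorem loopOfHom_mem_loopSubgroup {P : ∀ ⦃a b : Generators Y⦄, (a ⟶ b) → Prop} {a b : Generators Y}
    (e : a ⟶ b) (he : P e) : loopOfHom T (of e) ∈ loopSubgroup T P :=
  Subgroup.subset_closure ⟨a, b, e, he, rfl⟩

/-- In the group `End r` of a groupoid, the categorical inverse is the group inverse.
[cite: LyndonSchupp2001, Ch. I Prop. 3.7] -/
theorem inv_eq_inv' (x : End (rootObj T)) : CategoryTheory.inv x = x⁻¹ := by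
  rw [← Groupoid.inv_eq_inv]; rfl

/-- Composition of two elements of a subgroup of `End r` stays in the subgroup (composition is
multiplication in the opposite order). [cite: LyndonSchupp2001, Ch. I Prop. 3.7] -/
theorem comp_mem {K : Subgroup (End (rootObj T))} {x y : End (rootObj T)} (hx : x ∈ K) (hy : y ∈ K) :
    x ≫ y ∈ K :=
  K.mul_mem hy hx

/-- The factor contributed by one arrow in the telescoping identity lies in the loop subgroup: for a
forward arrow it is the loop itself, for a backward arrow the inverse of the loop.
[cite: LyndonSchupp2001, Ch. I Prop. 3.7] -/
theorem arrowFactor_mem (P : ∀ ⦃a b : Generators Y⦄, (a ⟶ b) → Prop) {b c : Symmetrify (Generators Y)}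
    (f : b ⟶ c) (hf : SymmArrowSat P f) :
    (treeHom T (obj b) ≫ homOfSymmArrow f ≫ inv (treeHom T (obj c)) : End (rootObj T)) ∈
      loopSubgroup T P := by
  match f, hf with
  | Sum.inl e, hf => exact loopOfHom_mem_loopSubgroup T e hf
  | Sum.inr e, hf =>
    have hl : (treeHom T (obj b) ≫ homOfSymmArrow (Sum.inr e) ≫ inv (treeHom T (obj c)) :
        End (rootObj T)) = (loopOfHom T (of e))⁻¹ := by
      refine Eq.trans ?_ (inv_eq_inv' T (loopOfHom T (of e)))
      simp [homOfSymmArrow, loopOfHom]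
    exact (congrArg (fun z => z ∈ loopSubgroup T P) hl).mpr
      (inv_mem (loopOfHom_mem_loopSubgroup T e hf))

/-- **Telescoping.**  For a path `p` from the root to `a` in the symmetrised generating quiver all of whose
arrows satisfy `P`, the element `homOfSymmPath T p ≫ inv (treeHom T a)` of the root vertex group lies in
the subgroup generated by the loops of the `P`-arrows: insert `inv (treeHom b) ≫ treeHom b` at every
intermediate vertex `b`. [cite: LyndonSchupp2001, Ch. I Prop. 3.7] -/
theorem homOfSymmPath_comp_inv_treeHom_mem (P : ∀ ⦃a b : Generators Y⦄, (a ⟶ b) → Prop) :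
    ∀ {a : Symmetrify (Generators Y)} (p : Path (rootVtx T) a),
      PathForall T P p →
      (homOfSymmPath T p ≫ inv (treeHom T (obj a)) : End (rootObj T)) ∈ loopSubgroup T P
  | _, Path.nil, _ => by
    have h1 : (homOfSymmPath T (Path.nil : Path (rootVtx T) (rootVtx T)) ≫
        inv (treeHom T (obj (rootVtx T))) : End (rootObj T)) = (1 : End (rootObj T)) := by
      rw [homOfSymmPath_nil, End.one_def]
      simp
    exact (congrArg (fun z => z ∈ loopSubgroup T P) h1).mpr (one_mem _)
  | _, Path.cons (b := b) (c := c) p f, hp => by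
    have ih := homOfSymmPath_comp_inv_treeHom_mem P p hp.1
    -- split off the last arrow, inserting `inv (treeHom b) ≫ treeHom b`
    have key : (homOfSymmPath T (p.cons f) ≫ inv (treeHom T (obj c)) : End (rootObj T)) =
        (homOfSymmPath T p ≫ inv (treeHom T (obj b))) ≫
          (treeHom T (obj b) ≫ homOfSymmArrow f ≫ inv (treeHom T (obj c))) := by
      rw [homOfSymmPath_cons]
      simp
    exact (congrArg (fun z => z ∈ loopSubgroup T P) key).mpr
      (comp_mem T ih (arrowFactor_mem T P f hp.2))

/-- A closed path at the root all of whose arrows satisfy `P` spells an element of the subgroup generated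
by the loops of the `P`-arrows. [cite: LyndonSchupp2001, Ch. I Prop. 3.7] -/
theorem homOfSymmPath_mem_loopSubgroup (P : ∀ ⦃a b : Generators Y⦄, (a ⟶ b) → Prop)
    (p : Path (rootVtx T) (rootVtx T)) (hp : PathForall T P p) :
    (homOfSymmPath T p : End (rootObj T)) ∈ loopSubgroup T P := by
  have h := homOfSymmPath_comp_inv_treeHom_mem T P p hp
  have h2 : (homOfSymmPath T p ≫ inv (treeHom T (obj (rootVtx T))) : End (rootObj T)) =
      homOfSymmPath T p := by
    simp
  exact (congrArg (fun z => z ∈ loopSubgroup T P) h2).mp h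

end

end FreeGroupoidTree

end Literature.GroupTheory.CombinatorialGroupTheory
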